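import Mathlib
import Summits.MatrixMultiplication.Statement
import Summits.MatrixMultiplication.MatrixMultiplication.Theorems.GraphEquationsKernelFieldRung

/-!
# The degree-`4` specimens satisfy the kernel-field clause (`GraphEquations`, kernel M77)

Decomp-mm node «GraphEquations» (lens 5); attacked leaf `MultiplicityReduction`
(stmt-MatrixMultiplication-27806); target of the node, VERBATIM: `_root_.MatrixMultiplication`.

Companion of M76 (`GraphEquationsKernelFieldRung`): the one-round kernel-field dial
`KernelFieldClauseDeg D K` asks, for every correct degree-`≤ D` system `E`, for a KERNEL FIELD `μ`
exposed at cost `≤ c·(cost E + n²)` such that EVERY system containing the `μ`-deflation of `E` is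
ideal-initially-isolated to order `K` over some base pair; `KernelFieldClauseDeg 4 K → ω₄ = ω` for
`K ≤ 2` (M76).  The two specimen families of degree `4` that refuted the ORDER dial
`DegreeBoundsIsoOrder 4 K` (M71, M75) satisfy the clause in its strongest form — target order `1`,
over EVERY base pair, relative budget `1`, in every system containing the deflation (not only the
forward-mode AD output):

* `EqSystem.IsRigidQuad.kernelField_clause` / `….kernelFieldClauseDeg_clause`: RIGID QUADRIC systems
  (chains `f_{p_i} - f_{p_{i+1}}²`, squares `f_q²`, …): the CONSTANT field `γ` of M72
  (`exists_rigid_direction`, ISO), program `constSystem γ` of cost `n²`;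
* `fan_kernelField_clause` / `fan_kernelFieldClauseDeg_clause`: the FAN (M75), which admits no
  non-zero constant kernel field: the base-LINEAR field `fanField` (`μ_{p₁} = -1`, `μ_{p₀} = y`),
  program `fanFieldSystem` of cost `3`.  This exports the relation `E.DeflatesTo (fanField h3) E'`
  that M75's `fan_purified_by_linear_field` kept internal (dossier item W1).

Neither family needs a kernel field of `(a,b)`-degree `≥ 2`, a second round, or a super-linear
field budget.  (Target order `1` in ONE round is nevertheless too much to ask of all degree-`4`
systems: the CUBIC specimen of the companion kernel M78, `GraphEquationsCubicSpecimen`, refutes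
`KernelFieldClauseDeg 4 1`; the dial that stands is `KernelFieldClauseDeg 4 2`.)

Finally `kernelField_expClass_iff_efmDeg` records WHY the dial has to be uniform: the exponent-class
reading of the critic's `KFC_D` — `∀ β ≥ 2, EqAdmissibleDeg D β → ∀ β' > β, EqAdmissibleKernelField β' K`
— is literally EQUIVALENT to `EquationsForceMultiplicationDeg D` (for `1 ≤ K ≤ 2`), i.e. a costume of
the rung it was meant to imply.  No `sorry`.

Sources: Leykin–Verschelde–Zhao, TCS 359 (2006) [doi:10.1016/j.tcs.2006.02.018], Thm 3.1;
[BurgisserClausenShokrollahi1997, §7.1, Problem 16.3].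
-/

set_option linter.dupNamespace false

noncomputable section

namespace Summit.MatrixMultiplication.MatrixMultiplication.Theorems.GraphEquations

open MvPolynomial Matrix Literature.Computability.AlgebraicComplexity
open Literature.Computability.AlgebraicComplexity.ArithCircuit

variable {n : ℕ}

/-! ## Rigid quadric systems: a constant field -/

/-- **Rigid quadric systems: a CONSTANT kernel field deflates to order `1` over EVERY base pair**, in
every system containing the deflation (universal form of M72's step). -/
theorem EqSystem.IsRigidQuad.kernelField_clause {E : EqSystem n} (hR : E.IsRigidQuad) (hE : E.Correct) :
    ∃ γ : Fin n × Fin n → ℂ,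
      (∀ j ∈ E.tests, derivC (fun q => C (γ q)) (E.testPoly j) ∈ graphIdeal n) ∧
      ∀ E' : EqSystem n, E.DeflatesTo (fun q => C (γ q)) E' → ∀ y, E'.IdealInitIsolatedAt 1 y := by
  classical
  choose l a hla using fun o : Fin E.tests.length => hR (E.tests.get o) (List.get_mem _ o)
  obtain ⟨γ, hγK, hγ⟩ := exists_rigid_direction l a (EqSystem.fibre_isolated hE l a hla)
  refine ⟨γ, fun j hj => ?_, fun E' hD y => ?_⟩
  · obtain ⟨o, ho⟩ := List.get_of_mem hj
    have h0 := constantCoeff_polarDeriv_rigidF (l o) γ (a o) (hγK o)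
    rw [homogeneousComponent_zero, C_eq_zero] at h0
    rw [← ho, hla o, ← substF_rigidF, ← substF_polarDeriv, substF_mem_graphIdeal_iff, constantCoeff_eq]
    exact h0
  have hmem : ∀ t, (∃ j' ∈ E'.tests, E'.testPoly j' = t) →
      t ∈ Ideal.span (Set.range fun o' : Fin E'.tests.length => E'.testPoly (E'.tests.get o')) := by
    rintro t ⟨j', hj', rfl⟩
    obtain ⟨o', ho'⟩ := List.get_of_mem hj'
    exact Ideal.subset_span ⟨o', congrArg E'.testPoly ho'⟩
  refine ⟨E.tests.length + E.tests.length,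
    Fin.append (fun o => E.testPoly (E.tests.get o))
      (fun o => derivC (fun q => C (γ q)) (E.testPoly (E.tests.get o))),
    fun i => ?_, fun _ => 1,
    Fin.append (fun o => rigidF (l o) (a o)) (fun o => polarDeriv (fun q => C (γ q)) (rigidF (l o) (a o))),
    fun _ => le_rfl, fun i => ?_, fun i j hj => ?_, fun F₀ hF => hγ F₀ (fun o => ?_) (fun o => ?_)⟩
  · induction i using Fin.addCases with
    | left o => simp only [Fin.append_left]; exact hmem _ (hD.1 _ (List.get_mem _ o))
    | right o => simp only [Fin.append_right]; exact hmem _ (hD.2 _ (List.get_mem _ o))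
  · induction i using Fin.addCases with
    | left o => simp only [Fin.append_left, substF_rigidF, hla]
    | right o => simp only [Fin.append_right, substF_polarDeriv, substF_rigidF, hla]
  · have hj0 : j = 0 := by simp only at hj; omega
    subst hj0
    induction i using Fin.addCases with
    | left o =>
      simp only [Fin.append_left]
      rw [homogeneousComponent_rigidF, if_neg (by norm_num), if_neg (by norm_num), add_zero]
    | right o => simp only [Fin.append_right]; exact constantCoeff_polarDeriv_rigidF _ _ _ (hγK o)
  · have h := hF (Fin.castAdd _ o)
    simp only [Fin.append_left] at h
    rw [homogeneousComponent_rigidF, if_pos rfl, if_neg (by norm_num), add_zero,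
      map_eval_map_C, eval_linFormPoly, eval_linFormPoly, dotProduct_zero] at h
    exact h
  · have h := hF (Fin.natAdd _ o)
    simp only [Fin.append_right] at h
    rw [homogeneousComponent_polarDeriv, homogeneousComponent_rigidF,
      if_neg (by norm_num), if_pos rfl, zero_add, ← map_polarDeriv, map_eval_map_C,
      eval_polarDeriv_matQuadPoly, eval_polarDeriv_matQuadPoly, mulVec_zero, dotProduct_zero] at h
    exact h

/-- Hence the KFC clause holds on the rigid quadric class for every target order `K ≥ 1`, with the
field program `constSystem γ` of cost `n²` (relative budget `1`). -/
theorem EqSystem.IsRigidQuad.kernelFieldClauseDeg_clause {E : EqSystem n} (hR : E.IsRigidQuad)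
    (hE : E.Correct) {K : ℕ} (hK : 1 ≤ K) :
    ∃ (μ : Fin n × Fin n → MvPolynomial (MatMulVars n) ℂ) (Eμ : EqSystem n),
      Eμ.circuit.IsFanInTwo ∧ (∀ q, ∃ j ∈ Eμ.tests, Eμ.testPoly j = liftAB n (μ q)) ∧
      (∀ j ∈ E.tests, derivC μ (E.testPoly j) ∈ graphIdeal n) ∧
      Eμ.cost ≤ 1 * (E.cost + n * n) ∧
      ∀ E' : EqSystem n, E.DeflatesTo μ E' → ∃ y, E'.IdealInitIsolatedAt K y := by
  obtain ⟨γ, hKF, hgood⟩ := hR.kernelField_clause hE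
  refine ⟨fun q => C (γ q), constSystem γ, constSystem_isFanInTwo γ,
    fun q => ⟨_, ?_, constSystem_testPoly γ q⟩, hKF,
    by rw [constSystem_cost, one_mul]; exact Nat.le_add_left _ _,
    fun E' hD => ⟨fun _ => 0, (hgood E' hD _).mono_order hK⟩⟩
  simp only [constSystem, List.mem_range]
  exact (Fintype.equivFin (Fin n × Fin n) q).isLt

/-! ## The fan: a base-linear field -/

/-- **The fan: the base-LINEAR kernel field `fanField` deflates to order `1` over EVERY base pair**, in
every system containing the deflation (universal form of M75's step; exports `E.DeflatesTo (fanField h3) E'`). -/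
theorem fan_kernelField_clause (h3 : 3 ≤ n * n) {E : EqSystem n}
    (hto : ∀ j ∈ E.tests, ∃ i, E.testPoly j = fanTest h3 i)
    (hfrom : ∀ i, ∃ j ∈ E.tests, E.testPoly j = fanTest h3 i) :
    (∀ j ∈ E.tests, derivC (fanField h3) (E.testPoly j) ∈ graphIdeal n) ∧
      ∀ E' : EqSystem n, E.DeflatesTo (fanField h3) E' → ∀ y, E'.IdealInitIsolatedAt 1 y := by
  classical
  refine ⟨fun j hj => ?_, fun E' hD y => ?_⟩
  · obtain ⟨i, hi⟩ := hto j hj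
    rw [hi]; exact fanField_kernel h3 i
  have hmem : ∀ t, (∃ j' ∈ E'.tests, E'.testPoly j' = t) →
      t ∈ Ideal.span (Set.range fun o' : Fin E'.tests.length => E'.testPoly (E'.tests.get o')) := by
    rintro t ⟨j', hj', rfl⟩
    obtain ⟨o', ho'⟩ := List.get_of_mem hj'
    exact Ideal.subset_span ⟨o', congrArg E'.testPoly ho'⟩
  have i1lt : 1 < n * n := by omega
  have hG' : polarDeriv (fanField h3) (fanG h3 ⟨1, i1lt⟩) = C 2 * X (chainPos n ⟨1, i1lt⟩) := by
    simp only [fanG, show (1 : ℕ) ≠ 0 from by norm_num, if_false, if_true, polarDeriv_sub', polarDeriv_X,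
      sq, polarDeriv_mul, fanField_chainPos, show (2 : ℕ) ≠ 0 from by norm_num,
      show (2 : ℕ) ≠ 1 from by norm_num, map_zero, map_neg, map_one, map_ofNat]
    ring
  refine ⟨n * n + 1, Fin.append (fun i => fanTest h3 i) (fun _ => derivC (fanField h3) (fanTest h3 ⟨1, i1lt⟩)),
    fun o => ?_, fun _ => 1, Fin.append (fanG h3) (fun _ => C 2 * X (chainPos n ⟨1, i1lt⟩)),
    fun _ => le_rfl, fun o => ?_, fun o j hj => ?_, fun F₀ hF => ?_⟩
  · induction o using Fin.addCases with
    | left i =>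
      simp only [Fin.append_left]
      obtain ⟨j, hj, hji⟩ := hfrom i
      obtain ⟨j', hj', h'⟩ := hD.1 j hj
      exact hmem _ ⟨j', hj', h'.trans hji⟩
    | right i =>
      simp only [Fin.append_right]
      obtain ⟨j, hj, hji⟩ := hfrom ⟨1, i1lt⟩
      obtain ⟨j', hj', h'⟩ := hD.2 j hj
      exact hmem _ ⟨j', hj', by rw [h', hji]⟩
  · induction o using Fin.addCases with
    | left i => simp only [Fin.append_left, substF_fanG]
    | right i => simp only [Fin.append_right]; rw [← hG', substF_polarDeriv, substF_fanG]
  · have hj0 : j = 0 := by simp only at hj; omega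
    subst hj0
    induction o using Fin.addCases with
    | left i =>
      simp only [Fin.append_left]
      rw [homogeneousComponent_zero, ← constantCoeff_eq, C_eq_zero]
      unfold fanG; split_ifs <;> simp [constantCoeff_X]
    | right i =>
      simp only [Fin.append_right]
      rw [homogeneousComponent_zero, ← constantCoeff_eq, C_eq_zero]; simp [constantCoeff_X]
  · have hX : ∀ q : Fin n × Fin n, homogeneousComponent 1 (X q : FPoly n) = X q := fun q =>
      by rw [homogeneousComponent_of_mem ((mem_homogeneousSubmodule _ _).2 (isHomogeneous_X _ q)), if_pos rfl]
    have hX2 : ∀ q : Fin n × Fin n, homogeneousComponent 1 ((X q : FPoly n) ^ 2) = 0 := fun q => by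
      rw [homogeneousComponent_of_mem ((mem_homogeneousSubmodule _ _).2 ((isHomogeneous_X _ q).pow 2)),
        if_neg (by norm_num)]
    have hval : ∀ i : Fin (n * n), i.val ≠ 0 → i.val ≠ 1 → i.val ≠ 2 → F₀ (chainPos n i) = 0 :=
      fun i hi0 hi1 hi2 => by
        simpa only [Fin.append_left, fanG, hi0, hi1, hi2, if_false, hX, map_X, eval_X, Pi.zero_apply]
          using hF (Fin.castAdd 1 i)
    have h2 : F₀ (chainPos n ⟨2, by omega⟩) = 0 := by
      have h := hF (Fin.castAdd 1 ⟨1, i1lt⟩)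
      simp only [Fin.append_left, fanG, show (1 : ℕ) ≠ 0 from by norm_num, if_false, if_true, map_sub,
        hX, hX2, sub_zero, map_X, eval_X, Pi.zero_apply] at h
      exact h
    have h1 : F₀ (chainPos n ⟨1, i1lt⟩) = 0 := by
      have h := hF (Fin.natAdd (n * n) (0 : Fin 1))
      simp only [Fin.append_right, homogeneousComponent_C_mul, hX, map_mul, map_C, map_X, eval_C, eval_X,
        Pi.zero_apply, mul_zero] at h
      simpa using h
    have h0 : F₀ (chainPos n ⟨0, by omega⟩) = 0 := by
      have h := hF (Fin.castAdd 1 ⟨0, by omega⟩)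
      simp only [Fin.append_left, fanG, if_true, map_add, homogeneousComponent_C_mul, hX, map_mul, map_C,
        map_X, eval_C, eval_X, Pi.zero_apply, mul_zero, add_zero, zero_add, h1] at h
      exact h
    funext q
    exact chainPos_cases h3 (P := fun q => F₀ q = 0) h0 h1 h2 hval q

/-- Hence the KFC clause holds on fan systems for every target order `K ≥ 1`, with the field program
`fanFieldSystem` of cost `3` (relative budget `1`). -/
theorem fan_kernelFieldClauseDeg_clause (h3 : 3 ≤ n * n) {E : EqSystem n}
    (hto : ∀ j ∈ E.tests, ∃ i, E.testPoly j = fanTest h3 i)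
    (hfrom : ∀ i, ∃ j ∈ E.tests, E.testPoly j = fanTest h3 i) {K : ℕ} (hK : 1 ≤ K) :
    ∃ (μ : Fin n × Fin n → MvPolynomial (MatMulVars n) ℂ) (Eμ : EqSystem n),
      Eμ.circuit.IsFanInTwo ∧ (∀ q, ∃ j ∈ Eμ.tests, Eμ.testPoly j = liftAB n (μ q)) ∧
      (∀ j ∈ E.tests, derivC μ (E.testPoly j) ∈ graphIdeal n) ∧
      Eμ.cost ≤ 1 * (E.cost + n * n) ∧
      ∀ E' : EqSystem n, E.DeflatesTo μ E' → ∃ y, E'.IdealInitIsolatedAt K y := by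
  obtain ⟨hKF, hgood⟩ := fan_kernelField_clause h3 hto hfrom
  refine ⟨fanField h3, fanFieldSystem h3, fanFieldSystem_isFanInTwo h3, fanFieldSystem_exposes h3, hKF, ?_,
    fun E' hD => ⟨fun _ => 0, (hgood E' hD _).mono_order hK⟩⟩
  have hc : (fanFieldSystem h3).cost = 3 := rfl
  rw [hc, one_mul]; exact le_add_left h3

/-- **THE DEGREE-`4` SPECIMENS IN KERNEL-FIELD CURRENCY.**  For `n² ≥ 3` there are correct degree-`4`
systems outside the order-`2` engine over EVERY base pair (a chain realisation, order-blind below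
`2^{n²}`, and a fan realisation, order-blind below `4` and without constant kernel fields), and BOTH
satisfy the clause of `KernelFieldClauseDeg 4 1` with relative budget `1`. -/
theorem degree_four_specimens_satisfy_clause (h3 : 3 ≤ n * n) :
    ∃ Ec Ef : EqSystem n,
      (Ec.Correct ∧ Ec.IsDegLe 4 ∧ Ec.IsRigidQuad ∧ ∀ K, K < 2 ^ (n * n) → ∀ y, ¬ Ec.IdealInitIsolatedAt K y) ∧
      (Ef.Correct ∧ Ef.IsDegLe 4 ∧ (∀ K, K < 4 → ∀ y, ¬ Ef.IdealInitIsolatedAt K y) ∧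
        ∀ γ : Fin n × Fin n → ℂ,
          (∀ j ∈ Ef.tests, derivC (fun q => C (γ q)) (Ef.testPoly j) ∈ graphIdeal n) → γ = 0) ∧
      ∀ E ∈ [Ec, Ef], ∃ (μ : Fin n × Fin n → MvPolynomial (MatMulVars n) ℂ) (Eμ : EqSystem n),
        Eμ.circuit.IsFanInTwo ∧ (∀ q, ∃ j ∈ Eμ.tests, Eμ.testPoly j = liftAB n (μ q)) ∧
        (∀ j ∈ E.tests, derivC μ (E.testPoly j) ∈ graphIdeal n) ∧
        Eμ.cost ≤ 1 * (E.cost + n * n) ∧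
        ∀ E' : EqSystem n, E.DeflatesTo μ E' → ∃ y, E'.IdealInitIsolatedAt 1 y := by
  have hn : 1 ≤ n := Nat.pos_of_ne_zero fun h => by subst h; omega
  obtain ⟨Ec, hEc, hrig, -, hmaskc⟩ := exists_chainSystem_rigid hn
  obtain ⟨Ef, hEf, hdegf, hto, hfrom, hmaskf, hconst⟩ := exists_fanSystem h3
  refine ⟨Ec, Ef, ⟨hEc, hrig.isDegLe_four, hrig, hmaskc⟩, ⟨hEf, hdegf, hmaskf, hconst⟩, fun E hE => ?_⟩
  simp only [List.mem_cons, List.mem_nil_iff, or_false] at hE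
  rcases hE with rfl | rfl
  · exact hrig.kernelFieldClauseDeg_clause hEc le_rfl
  · exact fan_kernelFieldClauseDeg_clause h3 hto hfrom le_rfl

/-! ## Why the dial is uniform: the exponent-class reading of `KFC_D` is `EFM_D` itself -/

/-- **The exponent-class kernel-field rung is a costume of `EFM_D`.**  For `1 ≤ K ≤ 2`,
`(∀ β ≥ 2, EqAdmissibleDeg D β → ∀ β' > β, EqAdmissibleKernelField β' K) ↔ EquationsForceMultiplicationDeg D`:
`→` by `EqAdmissibleKernelField.omega_le` and density, `←` because `ω < β'` already gives the rung
(`eqAdmissibleKernelField_of_omega_lt`, M76).  Hence only a UNIFORM clause (`KernelFieldClauseDeg`) can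
carry content between `EqAdmissibleDeg D` and `ω ≤ β`. -/
theorem kernelField_expClass_iff_efmDeg {D K : ℕ} (hK1 : 1 ≤ K) (hK2 : K ≤ 2) :
    (∀ β : ℝ, 2 ≤ β → EqAdmissibleDeg D β → ∀ β' : ℝ, β < β' → EqAdmissibleKernelField β' K) ↔
      EquationsForceMultiplicationDeg D := by
  constructor
  · intro h β hβ hA
    exact le_of_forall_gt_imp_ge_of_dense fun β' hβ' => (h β hβ hA β' hβ').omega_le hK2 (hβ.trans hβ'.le)
  · intro h β hβ hA β' hβ'
    exact eqAdmissibleKernelField_of_omega_lt ((h β hβ hA).trans_lt hβ') hK1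

end Summit.MatrixMultiplication.MatrixMultiplication.Theorems.GraphEquations

end
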